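import Summits.NavierStokesRegularity.NavierStokesRegularity.Theses.FilamentSkeletonRss
import Summits.NavierStokesRegularity.NavierStokesRegularity.Theorems.FilamentSkeletonRssSkeletonJ1GStubNormalBlock

/-!
# `NormalBlockMatchedL` (child stmt-NavierStokesRegularity-23322 of `SkeletonJ1L`, stmt-…-23296; Variant A1L, rigid matched cores) — PROVED BY NAME

DIRECTOR-NS dss_111 port P3 (tenure ns-filament-repair-plan g23/g24 owed port (c); lane `ns-filament-19175-p1` g14).  The route child
`Theses.FilamentSkeletonRss.NormalBlockMatchedL` is the one-conjunct twin of the CLOSED A1G child `NormalBlockMatched` (stmt-28312 ✓, p647414 +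
p648664): clause 12 (normal block: trace `< 0`, determinant `> 0` at the stagnation points, for SOME normal frames) from the flat clause block in
the near-straight regime (`‖X′(τ) − X′(σ)‖ ≤ Rb`, `|w′| ≤ Λ`, core-area floor `Λ⁻¹ ≤ Aa`), matched kernel, `2Kρ ≤ 1`, `Γ ≥ Γ₀(consts)`.
Variant A1L swaps exactly ONE conjunct of the flat block — the passive core-area law `w·A′ = (3/2 − w′)·A + 4` becomes the RIGID matched core
`1 ≤ KA·Aa j (c j) ∧ (‖X j τ‖ ≤ 2Rb√(Γ log Γ) → Aa j τ = Aa j (c j))` — and the landed proof of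
`Theorems.SkeletonJ1GStubNormalBlock.stub_normalBlock` reads that conjunct ONLY through its first component `Differentiable ℝ (Aa j)`, which both
variants share; so the proof below is that proof RE-RUN VERBATIM over the L-block (same destructuring, same constants, same threshold
`Γ₀ = max(exp((Rw/Rb)²+1), (7104πK m₂)²/m₁, 312π m₂(cgρ+2Rw)/(cg⁴ρ³), 4π m₂(12N(ρ+2Rw)/(θ₀cgρ³)+2θ₀⁻¹+2)/θ₀, m₂/Rw²)`, `m₁ = κ(max Λ 1)⁻¹`,
`m₂ = 5κ(|KA|+1)`, `κ = e^{−(1+γ_E−log 2)}`), via `MatchedKernel.matched_clause12_of_skeleton_core` and the frame construction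
`SkeletonJ1GStubNormalBlock.exists_frame_pair` imported by name.  The theorem is NAMED `stub_normalBlockL` = the registered stub of the BC3
skeleton of record `near_straight_newton_L.lean` (8bb59219…, stmt-23296), typed as the route decl by FQ name.
HONEST FRAMING: bookkeeping about a HYPOTHETICAL filament skeleton on the NEGATIVE side of a MODEL route; `SkeletonJ1L` stays OPEN (children
23320 / 23321 open); nothing here bears on Navier–Stokes regularity or blow-up. [folklore]
-/

set_option linter.dupNamespace false

noncomputable section

namespace Summit.NavierStokesRegularity.NavierStokesRegularity.Theorems.FilamentSkeletonRssNormalBlockMatchedL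

open Set Function Filter MeasureTheory Real
open Literature.Analysis.FluidPDE
open Summit.NavierStokesRegularity.NavierStokesRegularity.Theorems.SelectionBoxRJRung (chord_le)
open Summit.NavierStokesRegularity.NavierStokesRegularity.Theorems.MatchedKernel
open Summit.NavierStokesRegularity.NavierStokesRegularity.Theorems.SkeletonJ1GStubNormalBlock (exists_frame_pair)
open scoped InnerProductSpace Topology

/-- **Child 23322 `NormalBlockMatchedL` of the split of `SkeletonJ1L`, BY NAME** (= registered stub `stub_normalBlockL` of
`near_straight_newton_L.lean`): clause 12 from the rigid-core flat clauses in the near-straight regime, `2Kρ ≤ 1`, `Γ ≥ Γ₀(consts)` —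
the proof of `SkeletonJ1GStubNormalBlock.stub_normalBlock` (p647414) re-run verbatim; the swapped conjunct is read only through
`Differentiable ℝ (Aa j)`. [folklore] -/
theorem stub_normalBlockL :
    Summit.NavierStokesRegularity.NavierStokesRegularity.Theses.FilamentSkeletonRss.NormalBlockMatchedL := by
  unfold Summit.NavierStokesRegularity.NavierStokesRegularity.Theses.FilamentSkeletonRss.NormalBlockMatchedL
  intro N δ ρ K Λ Rw Rb cg θ₀ KA hN hδ hρ hRw hRb hcg hθ₀ hKρ
  have hκ0 : 0 < Real.exp (-(1 + Real.eulerMascheroniConstant - Real.log 2)) := Real.exp_pos _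
  -- the two core bounds (functions of `Λ`, `KA` only)
  obtain ⟨m₁, hm₁def⟩ : ∃ m₁ : ℝ, m₁ = Real.exp (-(1 + Real.eulerMascheroniConstant - Real.log 2)) * (max Λ 1)⁻¹ := ⟨_, rfl⟩
  obtain ⟨m₂, hm₂def⟩ : ∃ m₂ : ℝ, m₂ = 5 * Real.exp (-(1 + Real.eulerMascheroniConstant - Real.log 2)) * (|KA| + 1) := ⟨_, rfl⟩
  have hmax : 0 < max Λ 1 := lt_of_lt_of_le one_pos (le_max_right _ _)
  have hm₁ : 0 < m₁ := by rw [hm₁def]; exact mul_pos hκ0 (inv_pos.2 hmax)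
  have hm₂ : 0 < m₂ := by rw [hm₂def]; positivity
  refine ⟨max (max (max (Real.exp ((Rw / Rb) ^ 2 + 1)) ((7104 * Real.pi * K * m₂) ^ 2 / m₁))
      (max (312 * Real.pi * m₂ * (cg * ρ + 2 * Rw) / (cg ^ 4 * ρ ^ 3))
        (4 * Real.pi * m₂ * (12 * N * (ρ + 2 * Rw) / (θ₀ * cg * ρ ^ 3) + 2 * θ₀⁻¹ + 2) / θ₀))) (m₂ / Rw ^ 2), ?_⟩
  intro Γ hΓ γ α X w c Aa hflat hns
  have hΓ' := (le_max_left _ _).trans hΓ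
  have hΓ5 : m₂ / Rw ^ 2 ≤ Γ := (le_max_right _ _).trans hΓ
  have hΓ1 : Real.exp ((Rw / Rb) ^ 2 + 1) ≤ Γ := ((le_max_left _ _).trans (le_max_left _ _)).trans hΓ'
  have hΓ2 : (7104 * Real.pi * K * m₂) ^ 2 / m₁ ≤ Γ := ((le_max_right _ _).trans (le_max_left _ _)).trans hΓ'
  have hΓ3 : 312 * Real.pi * m₂ * (cg * ρ + 2 * Rw) / (cg ^ 4 * ρ ^ 3) ≤ Γ :=
    ((le_max_left _ _).trans (le_max_right _ _)).trans hΓ'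
  have hΓ4 : 4 * Real.pi * m₂ * (12 * N * (ρ + 2 * Rw) / (θ₀ * cg * ρ ^ 3) + 2 * θ₀⁻¹ + 2) / θ₀ ≤ Γ :=
    ((le_max_right _ _).trans (le_max_right _ _)).trans hΓ'
  have hΓpos : 0 < Γ := lt_of_lt_of_le (Real.exp_pos _) hΓ1
  have hG : 0 < Real.sqrt Γ := Real.sqrt_pos.2 hΓpos
  -- orthonormal frames along the tangents (any choice)
  have hfr : ∀ t : EuclideanSpace ℝ (Fin 3), ∃ mn : EuclideanSpace ℝ (Fin 3) × EuclideanSpace ℝ (Fin 3),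
      ‖t‖ = 1 → Orthonormal ℝ ![t, mn.1, mn.2] := fun t => by
    by_cases ht : ‖t‖ = 1
    · obtain ⟨mn, hmn⟩ := exists_frame_pair t ht
      exact ⟨mn, fun _ => hmn⟩
    · exact ⟨(0, 0), fun h => absurd h ht⟩
  choose fr hfr using hfr
  refine ⟨fun j => (fr (deriv (X j) (c j))).1, fun j => (fr (deriv (X j) (c j))).2, ?_⟩
  intro u v A T hu hv hA hT
  obtain ⟨-, -, hreg, hsep, hnoret, hesc, -, htan, hwaist, -, hbds, hstag, harea, hcone⟩ := hflat u v A T hu hv hA hT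
  obtain ⟨-, -, hAfloor⟩ := hns
  intro j
  have hon := hfr (deriv (X j) (c j)) ((hreg j).2.2.1 (c j))
  -- `Λ > 0` from clause 11
  have hΛ : 0 < Λ := by
    have h1 := (hstag j).2.2.1
    have h2 := (hstag j).2.2.2
    linarith
  -- the core floor `m₁ ≤ κ Aa`
  have hm₁A : ∀ k σ, m₁ ≤ Real.exp (-(1 + Real.eulerMascheroniConstant - Real.log 2)) * Aa k σ := by
    intro k σ
    rw [hm₁def]
    refine mul_le_mul_of_nonneg_left ?_ hκ0.le
    calc (max Λ 1)⁻¹ ≤ Λ⁻¹ := inv_anti₀ hΛ (le_max_left _ _)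
      _ ≤ Aa k σ := hAfloor k σ
  -- the core ceiling `κ Aa_j ≤ m₂` on the rotation window
  have hsq : Real.sqrt m₂ ≤ Rw * Real.sqrt Γ := by
    have h1 : m₂ ≤ Rw ^ 2 * Γ := by rwa [div_le_iff₀ (by positivity), mul_comm] at hΓ5
    calc Real.sqrt m₂ ≤ Real.sqrt (Rw ^ 2 * Γ) := Real.sqrt_le_sqrt h1
      _ = Rw * Real.sqrt Γ := by rw [Real.sqrt_mul (sq_nonneg _), Real.sqrt_sq hRw.le]
  have hm₂A : ∀ i σ, |σ - c i| ≤ Real.sqrt m₂ → Real.exp (-(1 + Real.eulerMascheroniConstant - Real.log 2)) * Aa i σ ≤ m₂ := by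
    intro i σ hσ
    have hXi : ContDiff ℝ 2 (X i) := (hreg i).1
    have hunit : ∀ τ, ‖deriv (X i) τ‖ = 1 := (hreg i).2.2.1
    have hch : ‖X i (c i) - X i σ‖ ≤ |σ - c i| := chord_le hXi hunit (c i) σ
    have hnorm : ‖X i σ‖ ≤ 2 * Rw * Real.sqrt Γ := by
      have h1 : ‖X i σ‖ ≤ ‖X i (c i)‖ + ‖X i (c i) - X i σ‖ := by
        have := norm_sub_norm_le (X i σ) (X i (c i))
        rw [norm_sub_rev] at this
        linarith
      linarith [hwaist i]
    have hsq2 : ‖X i σ‖ ^ 2 ≤ 4 * (Rw ^ 2 * Γ) := by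
      have h2 := pow_le_pow_left₀ (norm_nonneg _) hnorm 2
      have h3 : (2 * Rw * Real.sqrt Γ) ^ 2 = 4 * (Rw ^ 2 * Γ) := by
        rw [mul_pow, mul_pow, Real.sq_sqrt hΓpos.le]; ring
      rwa [h3] at h2
    have hRG : 0 < Rw ^ 2 * Γ := by positivity
    have hc := hcone i σ
    have hKA : KA * (Rw ^ 2 * Γ + ‖X i σ‖ ^ 2) ≤ (|KA| + 1) * (5 * (Rw ^ 2 * Γ)) := by
      have h0 : 0 ≤ Rw ^ 2 * Γ + ‖X i σ‖ ^ 2 := by positivity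
      calc KA * (Rw ^ 2 * Γ + ‖X i σ‖ ^ 2) ≤ |KA| * (Rw ^ 2 * Γ + ‖X i σ‖ ^ 2) :=
            mul_le_mul_of_nonneg_right (le_abs_self KA) h0
        _ ≤ (|KA| + 1) * (Rw ^ 2 * Γ + ‖X i σ‖ ^ 2) := mul_le_mul_of_nonneg_right (by linarith) h0
        _ ≤ (|KA| + 1) * (5 * (Rw ^ 2 * Γ)) := by
            refine mul_le_mul_of_nonneg_left ?_ (by positivity); linarith
    have hAa : Aa i σ ≤ 5 * (|KA| + 1) := by
      have h2 : Rw ^ 2 * Γ * Aa i σ ≤ (Rw ^ 2 * Γ) * (5 * (|KA| + 1)) :=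
        calc Rw ^ 2 * Γ * Aa i σ ≤ KA * (Rw ^ 2 * Γ + ‖X i σ‖ ^ 2) := hc
          _ ≤ (|KA| + 1) * (5 * (Rw ^ 2 * Γ)) := hKA
          _ = (Rw ^ 2 * Γ) * (5 * (|KA| + 1)) := by ring
      exact le_of_mul_le_mul_left h2 hRG
    rw [hm₂def]
    calc Real.exp (-(1 + Real.eulerMascheroniConstant - Real.log 2)) * Aa i σ
        ≤ Real.exp (-(1 + Real.eulerMascheroniConstant - Real.log 2)) * (5 * (|KA| + 1)) := mul_le_mul_of_nonneg_left hAa hκ0.le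
      _ = 5 * Real.exp (-(1 + Real.eulerMascheroniConstant - Real.log 2)) * (|KA| + 1) := by ring
  have h12 := matched_clause12_of_skeleton_core hδ hρ hRw hRb hcg hθ₀ hm₁ hm₂ hKρ hΓ1 hΓ2 hΓ3 hΓ4 hu
    (fun k => (harea k).1) hm₁A hm₂A hv
    (fun k => ⟨(hreg k).1, (hreg k).2.1, (hreg k).2.2.1, (hreg k).2.2.2.1⟩) hsep hnoret hesc htan hwaist hbds
    (fun k => ⟨(hstag k).1, (hstag k).2.2.1⟩) j hon
  rw [hA j]
  exact ⟨hon, h12.1, h12.2⟩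

/-- The same fact under the route's `_holds` naming convention. [folklore] -/
theorem normalBlockMatchedL_holds :
    Summit.NavierStokesRegularity.NavierStokesRegularity.Theses.FilamentSkeletonRss.NormalBlockMatchedL :=
  stub_normalBlockL

end Summit.NavierStokesRegularity.NavierStokesRegularity.Theorems.FilamentSkeletonRssNormalBlockMatchedL

end
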